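import Summits.HodgeConjecture.HodgeConjecture.Theorems.LimitExtensionHodgeFourfoldsOfSNC
import Summits.HodgeConjecture.HodgeConjecture.Theorems.LimitExtensionHodgeFourfoldsOfTwoFacts
import Summits.HodgeConjecture.HodgeConjecture.Theorems.LimitExtensionSpecialisationOfAlgebraicityOfLocalSpread
import Literature.AlgebraicGeometry.HodgeTheory.KodairaSerreSectionsAllDim
import Literature.AlgebraicGeometry.HodgeTheory.ComplexConjugationHolds

/-!
# Route LimitExtension · `HodgeFourfolds` (stmt-HodgeConjecture-10866) — Lefschetz `(1,1)` discharged

Since 2026-08-16 (18:27Z) the Lefschetz theorem on rational `(1,1)`-classes is a THEOREM of the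
tree (`lefschetzOneOne_rational_holds`, file `HodgeTheory/LefschetzOneOneHolds`: the Kodaira–Serre
sections `kodairaSerre_exists_globalSection_algebraicTwist_holds` by Serre's dimension count along a
transverse flag, then Čech integrality, the divisor of a meromorphic section and Chow), and so are
Hodge models (`nonempty_hodgeModel_holds`). (Below the Lefschetz theorem is spelt by the BODY of
`lefschetzOneOne_rational_holds`, i.e. `lefschetzOneOne_rational_of_kodairaSerre_fact
kodairaSerre_exists_globalSection_algebraicTwist_holds`, so that this file only imports
`KodairaSerreSectionsAllDim`.) This file feeds both into the reductions of
`Theorems/LimitExtensionHodgeFourfoldsOfSNC` / `…OfTwoFacts` / `…OfFacts`, so that the item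
`HodgeFourfolds` (Hodge models → `LimitExtensionFour` → `HypersurfaceHodgeFour` → the Hodge
conjecture for every smooth projective fourfold) is now closed modulo EXACTLY TWO inputs:

* ONE Hodge-theoretic named fact, in any of its three catalogued strengths — the snc principle of
  two types `Deligne1974_ker_pullback_eq_ker_pullback_snc` (Hodge III Prop. 8.2.7, snc case;
  `hodgeFourfolds_of_snc_of_specialisation`), Cor. 8.2.8 for arbitrary families
  `Deligne1974_ker_restrictCompl_eq_iSup_range_complexGysin`
  (`hodgeFourfolds_of_gysinKernel_of_specialisation`), or Prop. 8.2.7 in resolution form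
  `Deligne1974_ker_pullback_eq_ker_pullback_resolution`
  (`hodgeFourfolds_of_resolution_of_specialisation`);
* the route's specialisation item `SpecialisationOfAlgebraicity` (stmt-HodgeConjecture-2998), or
  its registered residual stub `localSpread` (spreading of fibrewise algebraic supports for a flat
  PROPER family over a smooth curve; `hodgeFourfolds_of_snc_of_localSpread`).

On a single fourfold the bookkeeping is now unconditional: `hodgeConjectureFor_four_of_hodgeTwoTwo`
(**the Hodge conjecture for a smooth projective complex fourfold is equivalent to the algebraicity
of its rational `(2,2)`-classes** — codimension `1` Lefschetz, `3` hard Lefschetz, `0`, `4`, `≥ 5`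
trivial, Hodge model by GAGA + Hodge decomposition), and `hodgeConjectureFor_four_of_supported_of_snc`
(from DIVISOR SUPPORT of the `(2,2)`-classes, granted the snc principle). Finally
`hodgeConjectureFor_four_of_two_facts_qp`: with the `∃`-clause of `LimitExtensionFour` tightened by
`IsQuasiProjectiveOver W` (the repair proposed for stmt-2998/2996), the Hodge conjecture for ALL
smooth projective fourfolds follows from the two cruxes and TWO named facts (the snc principle and
`spread_supports_over_smoothCurve`). No definitions, no new named facts, no sorry.
-/

noncomputable section

-- every declaration of this problem lives in `Summit.HodgeConjecture.HodgeConjecture.…` (summit = sub-problem)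
set_option linter.dupNamespace false

open CategoryTheory AlgebraicGeometry
open Literature.AlgebraicGeometry Literature.AlgebraicGeometry.Motives
open Literature.AlgebraicGeometry.HodgeTheory

namespace Summit.HodgeConjecture.HodgeConjecture.Theorems

/-! ### The item modulo one Hodge-theoretic fact and the specialisation item -/

/-- **`HodgeFourfolds` (stmt-HodgeConjecture-10866) from the snc principle of two types and the
specialisation item alone.** `hodgeFourfolds_of_snc` with its Lefschetz `(1,1)` hypothesis discharged
by the tree's theorem `lefschetzOneOne_rational_holds`. Remaining inputs: `hS`, the snc case of
Deligne's Hodge III Prop. 8.2.7 (named fact `Deligne1974_ker_pullback_eq_ker_pullback_snc`), and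
`hSp`, the route's support item `SpecialisationOfAlgebraicity` (stmt-HodgeConjecture-2998).
[cite: DeligneHodgeIII1974, Prop. 8.2.7 (p. 40)] [cite: DeligneGriffithsMorganSullivan1975, §5–§6]
[cite: VoisinHodgeI2002, Thm. 11.30] [cite: Murre1977, Remark 1 (p. 230)] -/
theorem hodgeFourfolds_of_snc_of_specialisation (hS : Deligne1974_ker_pullback_eq_ker_pullback_snc)
    (hSp : Theses.LimitExtension.SpecialisationOfAlgebraicity) :
    Theses.LimitExtension.HodgeFourfolds :=
  hodgeFourfolds_of_snc hS
    (lefschetzOneOne_rational_of_kodairaSerre_fact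
      kodairaSerre_exists_globalSection_algebraicTwist_holds) hSp

/-- **`HodgeFourfolds` from Deligne's Cor. 8.2.8 (arbitrary families) and the specialisation item.**
`hodgeFourfolds_of_two_facts` with Lefschetz `(1,1)` discharged (`lefschetzOneOne_rational_holds`).
[cite: DeligneHodgeIII1974, Cor. 8.2.8 (p. 40)] [cite: VoisinHodgeI2002, Thm. 11.30] -/
theorem hodgeFourfolds_of_gysinKernel_of_specialisation
    (hD : Deligne1974_ker_restrictCompl_eq_iSup_range_complexGysin)
    (hSp : Theses.LimitExtension.SpecialisationOfAlgebraicity) :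
    Theses.LimitExtension.HodgeFourfolds :=
  hodgeFourfolds_of_two_facts
    (lefschetzOneOne_rational_of_kodairaSerre_fact
      kodairaSerre_exists_globalSection_algebraicTwist_holds) hD hSp

/-- **`HodgeFourfolds` from Deligne's Prop. 8.2.7 in resolution form and the specialisation item.**
Prop. 8.2.7 gives Cor. 8.2.8 by the tree's `Deligne1974_ker_restrictCompl_eq_iSup_range_complexGysin_holds_of`.
[cite: DeligneHodgeIII1974, Prop. 8.2.7 and Cor. 8.2.8 (p. 40)] -/
theorem hodgeFourfolds_of_resolution_of_specialisation
    (h827 : Deligne1974_ker_pullback_eq_ker_pullback_resolution)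
    (hSp : Theses.LimitExtension.SpecialisationOfAlgebraicity) :
    Theses.LimitExtension.HodgeFourfolds :=
  hodgeFourfolds_of_gysinKernel_of_specialisation
    (Deligne1974_ker_restrictCompl_eq_iSup_range_complexGysin_holds_of h827) hSp

/-- **`HodgeFourfolds` from the snc principle and the registered residual stub of
stmt-HodgeConjecture-2998** (`localSpread`: for a flat proper family `f : W ⟶ T` over a smooth
irreducible curve whose fibres off `t₀` are smooth projective `2k`-folds on which `B` is algebraic,
ONE Zariski-closed `𝒵 ⊆ W` with `(≤ k)`-dimensional `t₀`-slice off which `B|_{W_t}` dies for all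
`t` outside a proper closed subset of `T` — relative Hilbert/Chow spreading plus flat limits; for
quasi-projective `W` this is the named fact `spread_supports_over_smoothCurve`). The stub gives the
item stmt-2998 by the tree's `specialisationOfAlgebraicity_of_localSpread`.
[cite: VoisinHodgeII2003, §3.3.1 and proof of Thm. 10.19] [cite: Fulton1998, §10.1]
[cite: DeligneHodgeIII1974, Prop. 8.2.7 (p. 40)] -/
theorem hodgeFourfolds_of_snc_of_localSpread (hS : Deligne1974_ker_pullback_eq_ker_pullback_snc)
    (localSpread : ∀ ⦃k : ℕ⦄ ⦃T W : SchemeOver ℂ⦄ (f : W ⟶ T) (t₀ : ComplexPoints T)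
      (B : complexBetti W (2 * k)), 0 < k →
      SmoothOfRelativeDimension 1 T.hom → IrreducibleSpace T.left → Flat f.left →
      IsProper f.left →
      (∀ t : ComplexPoints T, t ≠ t₀ → IsSmoothProjective (2 * k) (fiberOver f t) ∧
        complexBetti.map (fiberι f t) (2 * k) B ∈ algebraicClasses (fiberOver f t) k) →
      ∃ 𝒵 : Set W.left, IsClosed 𝒵 ∧
        (∀ m : ↥(fiberOver f t₀).left, (fiberι f t₀).left.base m ∈ 𝒵 →
          Order.height m + k ≤ (2 * k : ℕ)) ∧
        ∃ S' : Set T.left, IsClosed S' ∧ S' ≠ Set.univ ∧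
          ∀ t : ComplexPoints T, t.pt ∉ S' →
            complexBetti.restrictCompl (fiberOver f t) ((fiberι f t).left.base ⁻¹' 𝒵) (2 * k)
              (complexBetti.map (fiberι f t) (2 * k) B) = 0) :
    Theses.LimitExtension.HodgeFourfolds :=
  hodgeFourfolds_of_snc_of_specialisation hS (specialisationOfAlgebraicity_of_localSpread localSpread)

/-! ### One fourfold: the unconditional bookkeeping -/

/-- **The Hodge conjecture for a smooth projective complex fourfold reduces to its rational
`(2,2)`-classes** (unconditional). For `X` smooth projective of dimension `4`: if every rational
class of Hodge type `(2,2)` in `H⁴(X(ℂ); ℂ)` is algebraic, then `HodgeConjectureFor 4 X`. The Hodge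
model is `nonempty_hodgeModel_holds` (GAGA + Hodge decomposition), codimension `1` is the Lefschetz
theorem on `(1,1)`-classes `lefschetzOneOne_rational_holds`, codimension `3` is hard Lefschetz from
codimension `1` (Murre 1977, Remark 1: "the `(3,3)`-conjecture is true for any fourfold"),
codimensions `0`, `4`, `≥ 5` are elementary — all through `hodgeConjectureFor_four_of_middle`.
[cite: VoisinHodgeI2002, Thm. 11.30 and Thm. 6.25] [cite: Murre1977, Remark 1 (p. 230)] -/
theorem hodgeConjectureFor_four_of_hodgeTwoTwo {X : SchemeOver ℂ} (hX : IsSmoothProjective 4 X)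
    (hMid : ∀ c : complexBetti X (2 * 2), IsRationalClass c → IsOfHodgeType 4 X (2 * 2) 2 2 c →
      c ∈ algebraicClasses X 2) :
    HodgeConjectureFor 4 X :=
  hodgeConjectureFor_four_of_middle hX (nonempty_hodgeModel_holds hX)
    (fun _Y hY c hc hpp ↦ lefschetzOneOne_rational_of_kodairaSerre_fact
      kodairaSerre_exists_globalSection_algebraicTwist_holds hY c hc hpp) hMid

/-- **The Hodge conjecture for a smooth projective fourfold from DIVISOR SUPPORT of its rational
`(2,2)`-classes, granted the snc principle of two types.** If every rational `(2,2)`-class of `X`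
lies in `N¹H⁴(X(ℂ); ℂ)` (`supportedClasses X 4 1`), then — by the route decl `DivisorInduction` at
`(n, p) = (3, 2)` (`divisorInduction_of_snc827 hS`: log resolution of the supporting divisor, the
snc principle, Voisin's lift of Hodge classes along the Gysin surjection, Lefschetz `(1,1)` on the
resolved components, push-forward), every such class is algebraic, and
`hodgeConjectureFor_four_of_hodgeTwoTwo` concludes. [cite: DeligneHodgeIII1974, Prop. 8.2.7 and Cor. 8.2.8]
[cite: Thomas2005Nodes, Prop. 2] [cite: VoisinHodgeI2002, Thm. 11.30] -/
theorem hodgeConjectureFor_four_of_supported_of_snc (hS : Deligne1974_ker_pullback_eq_ker_pullback_snc)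
    {X : SchemeOver ℂ} (hX : IsSmoothProjective 4 X)
    (hN : ∀ c : complexBetti X (2 * 2), IsRationalClass c → IsOfHodgeType 4 X (2 * 2) 2 2 c →
      c ∈ supportedClasses X (2 * 2) 1) :
    HodgeConjectureFor 4 X :=
  hodgeConjectureFor_four_of_hodgeTwoTwo hX fun c hc hpp ↦
    divisorInduction_of_snc827 hS 3 2 one_le_two
      (fun _Y hY a ha haa ↦ lefschetzOneOne_rational_of_kodairaSerre_fact
        kodairaSerre_exists_globalSection_algebraicTwist_holds hY a ha haa) hX c hc hpp (hN c hc hpp)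

/-! ### All fourfolds from the tightened crux: two named facts -/

/-- **The Hodge conjecture for all smooth projective fourfolds from the two cruxes and TWO named
facts, granted a quasi-projective witness family.** `hodgeConjectureFor_four_of_three_facts_qp` with
its Kodaira–Serre hypothesis discharged (`kodairaSerre_exists_globalSection_algebraicTwist_holds`)
and Hodge models supplied by `nonempty_hodgeModel_holds`: the remaining named facts are the snc
principle (`hS`) and the spreading of supports over a smooth curve (`hF`,
`spread_supports_over_smoothCurve`, itself reduced in the tree to Verdier's generic local
triviality); `hLE` is the crux `LimitExtensionFour` with `IsQuasiProjectiveOver W` added to its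
`∃`-clause, `hH` the crux `HypersurfaceHodgeFour`. [cite: DeligneHodgeIII1974, Prop. 8.2.7]
[cite: VoisinHodgeII2003, §3.3.1] [cite: SerreGAGA1956, n° 16 Lemme 8] [cite: Murre1977, Remark 1 (p. 230)] -/
theorem hodgeConjectureFor_four_of_two_facts_qp (hS : Deligne1974_ker_pullback_eq_ker_pullback_snc)
    (hF : spread_supports_over_smoothCurve)
    (hLE : ∀ ⦃X : SchemeOver ℂ⦄, IsSmoothProjective 4 X → ∀ α : complexBetti X 4,
      IsRationalClass α → IsOfHodgeType 4 X 4 2 2 α →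
      ∃ (T W : SchemeOver ℂ) (f : W ⟶ T) (t₀ : ComplexPoints T) (g : X ⟶ fiberOver f t₀)
        (B : complexBetti W 4),
        SmoothOfRelativeDimension 1 T.hom ∧ IrreducibleSpace T.left ∧ Flat f.left ∧
        IsProper f.left ∧ IsQuasiProjectiveOver W ∧
        (∃ U : X.left.Opens, (U : Set X.left).Nonempty ∧ IsOpenImmersion (U.ι ≫ g.left)) ∧
        IsRationalClass B ∧
        (∀ t : ComplexPoints T, t ≠ t₀ →
          (∃ d : ℕ, IsSmoothHypersurface 4 d (fiberOver f t)) ∧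
          IsOfHodgeType 4 (fiberOver f t) 4 2 2 (complexBetti.map (fiberι f t) 4 B)) ∧
        α - complexBetti.map (g ≫ fiberι f t₀) 4 B ∈ supportedClasses X 4 1)
    (hH : Theses.LimitExtension.HypersurfaceHodgeFour) :
    ∀ ⦃X : SchemeOver ℂ⦄, IsSmoothProjective 4 X → HodgeConjectureFor 4 X :=
  hodgeConjectureFor_four_of_three_facts_qp hS kodairaSerre_exists_globalSection_algebraicTwist_holds
    hF (fun _n _X hX ↦ nonempty_hodgeModel_holds hX) hLE hH

end Summit.HodgeConjecture.HodgeConjecture.Theorems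

end
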